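import Summits.ResolutionOfSingularities.ResolutionOfSingularities.Theorems.HomologicalConductorNoZenoZMTDichotomy
import Summits.ResolutionOfSingularities.ResolutionOfSingularities.Theorems.HomologicalConductorNoZenoSeqFinite
import Summits.ResolutionOfSingularities.ResolutionOfSingularities.Theorems.HomologicalConductorNoZenoExitDivisorReach
import Summits.ResolutionOfSingularities.ResolutionOfSingularities.Theorems.HomologicalConductorNoZenoExceptionalBasePt
import Summits.ResolutionOfSingularities.ResolutionOfSingularities.Theorems.HomologicalConductorNoZenoBasePtsStrictAnti
import Literature.RingTheory.RegularLocalRing.QuotientDVR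
import Literature.AlgebraicGeometry.Resolution.NormalSurfaceSingularLocus
import Literature.AlgebraicGeometry.Resolution.QuadraticTransformsProofs
import HarnessLib

/-!
# Crux `NoZeno` / `NoZenoR` (stmt-ResolutionOfSingularities-16483 / -19943), line `sandwich-cluster`
# (= first-layer stubs of line `birth`, skeleton v11): **S2 `stub_regularOfBasePtsEmpty`** — assembly

Route `ResolutionOfSingularities/HomologicalConductor`.  OURS (cell res-hironaka); nothing here is a
statement of the manuscript under review.  S2 (v10/v11 registered text): in a sandwich context, a
stage `T_m` (`m ≥ m₀ + 1`) WITHOUT base points over `R` is regular.  Scheme-free proof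
(`L/res-L0-w44-stub-3/S2-PLAN.md`): (0) `dim R ≤ 1` ⇒ `T_m ⊇ R` is a Noetherian normal valuation
ring, regular; (a) REACH (`tower_le_seq`): `T_m ≤ S_N` for a least member of the quadratic sequence of
`R` along `O` (Abhyankar's union lemma); `N = 0` gives `T_m = R`; if `S_N` has dimension `≤ 1` it is
`O = E_{S_(N-1)}` (stub-3's (E)) and `S_(N-1)` is a base point; else (b) the ZMT dichotomy
(`…ZMTDichotomy.lean`) gives `T_m = S_N` or an exceptional divisor `W`, and (c) (stub-3,
`basePts_nonempty_of_exceptional_divisor`) an earlier member `S_j` with `E_{S_j} = W` is a base point.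
-/

noncomputable section

-- single-problem summit: the doubled namespace component `ResolutionOfSingularities` is forced
set_option linter.dupNamespace false

namespace Summit.ResolutionOfSingularities.ResolutionOfSingularities.Theorems.NoZeno.SandwichCluster

open Summit.ResolutionOfSingularities.ResolutionOfSingularities.Theses.HomologicalConductor
open Summit.ResolutionOfSingularities.ResolutionOfSingularities.Theorems.NoZeno.Birth
open Summit.ResolutionOfSingularities.ResolutionOfSingularities.Theorems
open Literature.AlgebraicGeometry.Resolution IsLocalRing Polynomial

variable {k K : Type} [Field k] [Field K] [Algebra k K]

/-! ## Step (0): a base of dimension `≤ 1` -/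

/-- **A regular local ring of `K` of dimension `≤ 1` is a valuation ring of `K`** (a field — then
equal to `K` — or a discrete valuation ring). [cite: Matsumura1987, Thm. 11.2] -/
theorem forall_mem_or_inv_mem_of_ringKrullDim_le_one (R : Subalgebra k K) [IsFractionRing ↥R K]
    (hreg : IsRegularLocalRing ↥R) (hdim : ringKrullDim ↥R ≤ 1) (z : K) : z ∈ R ∨ z⁻¹ ∈ R := by
  haveI := hreg
  haveI := isDomain_of_isRegularLocalRing ↥R
  by_cases hF : IsField ↥R
  · left
    obtain ⟨r, hr⟩ := (IsField.localization_map_bijective (M := nonZeroDivisors ↥R) (Rₘ := K)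
      zero_notMem_nonZeroDivisors hF).2 z
    rw [← hr]
    exact r.2
  · have hH1 : (maximalIdeal ↥R).height ≤ 1 := by
      rw [← IsLocalRing.maximalIdeal_height_eq_ringKrullDim] at hdim
      exact WithBot.coe_le_coe.mp hdim
    have hH0 : (maximalIdeal ↥R).height ≠ 0 := by
      intro h0
      have hd0 : ringKrullDim ↥R ≤ 0 := by
        rw [← IsLocalRing.maximalIdeal_height_eq_ringKrullDim, h0]; rfl
      haveI : Ring.KrullDimLE 0 ↥R := (Ring.krullDimLE_iff).mpr (by exact_mod_cast hd0)
      exact hF (Ring.KrullDimLE.isField_of_isDomain)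
    have h1 : ringKrullDim ↥R = 1 := by
      rw [← IsLocalRing.maximalIdeal_height_eq_ringKrullDim,
        le_antisymm hH1 (Order.one_le_iff_ne_zero.mpr hH0)]
      rfl
    haveI : IsDiscreteValuationRing ↥R :=
      Literature.RingTheory.RegularLocalRing.isDiscreteValuationRing_of_ringKrullDim_eq_one h1
    rcases ValuationRing.isInteger_or_isInteger ↥R z with ⟨r, hr⟩ | ⟨r, hr⟩
    · left; rw [← hr]; exact r.2
    · right; rw [← hr]; exact r.2

/-- **Step (0)**: if the regular base `R ≤ T_(n+1)` (`Frac R = K`) has dimension `≤ 1` then the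
normal stage `T_(n+1)` is regular (it is a Noetherian local valuation ring of `K`, of dimension
`≤ 1`). [cite: Matsumura1987, Thm. 11.2] -/
theorem isRegularLocalRing_of_ringKrullDim_base_le_one (O : ValuationSubring K) (A : Subalgebra k K)
    (hk : ∀ c : k, algebraMap k K c ∈ O) (hA : A.FG) (hfr : IsFractionRing ↥A K)
    (hAO : A.toSubring ≤ O.toSubring) (n : ℕ) (R : Subalgebra k K) [IsFractionRing ↥R K]
    (hreg : IsRegularLocalRing ↥R) (hdim : ringKrullDim ↥R ≤ 1) (hRT : R ≤ tower O A (n + 1)) :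
    IsRegularLocalRing ↥(tower O A (n + 1)) := by
  haveI := hfr
  haveI : IsNoetherianRing ↥(tower O A (n + 1)) := stub_towerNoetherian k K O A hk hA hfr hAO _
  haveI : IsLocalRing ↥(tower O A (n + 1)) := by
    obtain ⟨B, hBO, hTB⟩ := exists_tower_eq_loc O A hk hAO (n + 1)
    rw [hTB, loc_eq_locAt]; exact SyzygyFlattening.isLocalRing_locAt O B hBO
  haveI : IsIntegrallyClosed ↥(tower O A (n + 1)) :=
    d2rc_isIntegrallyClosed_tower_succ O A hk hA hfr hAO n
  have hT1 : ringKrullDim ↥(tower O A (n + 1)) ≤ 1 :=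
    ringKrullDim_le_one_of_forall_mem_or_inv_mem (tower O A (n + 1)) fun z =>
      (forall_mem_or_inv_mem_of_ringKrullDim_le_one R hreg hdim z).imp (fun h => hRT h)
        (fun h => hRT h)
  exact isRegularLocalRing_of_isIntegrallyClosed_of_ringKrullDim_le_one _ hT1

/-! ## Step (a): REACH -/

/-- **REACH.**  Let `(S_j)` be a sequence of quadratic transforms along `O` starting at the
two-dimensional regular `R` (`Frac R = K`, `O` dominating `R`).  Every stage `T_m` of the tower lies
in some `S_N`: `O = ⋃ S_j` (Abhyankar's union lemma), `T_m` is a localisation of a finitely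
generated `k`-algebra at its units, finitely many generators lie in a common `S_N`, and units of
`T_m ⊆ O` are `O`-units, inverted in the `O`-dominated `S_N`. [cite: Abhyankar1956Valuations, Lemma 12] -/
theorem tower_le_seq (O : ValuationSubring K) (A : Subalgebra k K)
    (hk : ∀ c : k, algebraMap k K c ∈ O) (hA : A.FG) (hfr : IsFractionRing ↥A K)
    (hAO : A.toSubring ≤ O.toSubring) (R : Subalgebra k K) [IsRegularLocalRing ↥R]
    [IsFractionRing ↥R K] (hdimR : ringKrullDim ↥R = 2) (seq : ℕ → Subring K)
    (hseq0 : seq 0 = R.toSubring) (hstep : ∀ i, IsQuadraticTransformAlong O (seq i) (seq (i + 1)))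
    (h0 : SubringDominates (seq 0) O.toSubring) (m : ℕ) :
    ∃ N, ∀ t ∈ tower O A m, t ∈ seq N := by
  classical
  haveI := hfr
  have hreg0 : IsRegularLocalRing ↥(seq 0) := by rw [hseq0]; exact ‹IsRegularLocalRing ↥R›
  have hdim0 : ringKrullDim ↥(seq 0) = 2 := by
    rw [ringKrullDim_eq_of_ringEquiv (RingEquiv.subringCongr hseq0)]; exact hdimR
  have hof : IsLocalRingOf (seq 0) := by
    rw [hseq0]
    refine ⟨(inferInstance : IsRegularLocalRing ↥R).toIsLocalRing, fun z => ?_⟩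
    obtain ⟨a, b, hb, rfl⟩ := IsFractionRing.div_surjective (A := ↥R) z
    exact ⟨a, a.2, b, b.2, fun h => nonZeroDivisors.ne_zero hb (Subtype.ext h), rfl⟩
  have hunion : ∀ z : K, z ∈ O ↔ ∃ i, z ∈ seq i :=
    AbhyankarQuadraticUnion_holds K O seq hreg0 hdim0 hof h0 hstep
  have hmono : Monotone seq := sequence_monotone hstep
  have hdomO : ∀ i, SubringDominates (seq i) O.toSubring := fun i => (sequence_dominates h0 hstep i).1
  -- `T_m` is the localisation of `k[σ]` at its units, `σ` finite
  obtain ⟨-, hTO, hET⟩ := tn_tower_invariant O A hk hA hfr hAO m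
  haveI := hET
  set σ : Finset ↥(tower O A m) := Algebra.EssFiniteType.finset k ↥(tower O A m) with hσ
  have hcond : ∀ s : ↥(tower O A m), ∃ t ∈ Algebra.adjoin k (σ : Set ↥(tower O A m)),
      IsUnit t ∧ s * t ∈ Algebra.adjoin k (σ : Set ↥(tower O A m)) :=
    (Algebra.essFiniteType_cond_iff k ↥(tower O A m) σ).mp
      (Algebra.EssFiniteType.isLocalization (R := k) (S := ↥(tower O A m)))
  -- a common index for the finitely many generators
  have hgen : ∀ x : ↥(tower O A m), ∃ i, (x : K) ∈ seq i := fun x =>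
    (hunion x).mp (hTO (Subalgebra.mem_toSubring.mpr x.2))
  choose idx hidx using hgen
  obtain ⟨N₀, hN₀⟩ : ∃ N₀, ∀ x ∈ σ, idx x ≤ N₀ :=
    ⟨σ.sup idx, fun x hx => Finset.le_sup hx⟩
  have hkR : ∀ c : k, algebraMap k K c ∈ seq N₀ := fun c => by
    exact hmono (Nat.zero_le N₀) (by rw [hseq0]; exact R.algebraMap_mem c)
  have hσN : ∀ x ∈ σ, (x : K) ∈ seq N₀ := fun x hx => hmono (hN₀ x hx) (hidx x)
  -- `k[σ] ⊆ S_{N₀}`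
  have hadj : ∀ {b : ↥(tower O A m)}, b ∈ Algebra.adjoin k (σ : Set ↥(tower O A m)) →
      (b : K) ∈ seq N₀ := by
    intro b hb
    induction hb using Algebra.adjoin_induction with
    | mem x hx => exact hσN x hx
    | algebraMap c => exact hkR c
    | add x y _ _ hx hy => rw [Subalgebra.coe_add]; exact (seq N₀).add_mem hx hy
    | mul x y _ _ hx hy => rw [Subalgebra.coe_mul]; exact (seq N₀).mul_mem hx hy
  refine ⟨N₀, fun t ht => ?_⟩
  obtain ⟨u, hu, huu, htu⟩ := hcond ⟨t, ht⟩
  have huK : (u : K) ∈ seq N₀ := hadj hu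
  have htuK : t * (u : K) ∈ seq N₀ := by
    have := hadj htu
    rwa [Subalgebra.coe_mul] at this
  -- `u` is a unit of `T_m ⊆ O`, hence of `O`, hence of `S_{N₀}`
  have hu0 : (u : K) ≠ 0 := fun h => huu.ne_zero (Subtype.ext h)
  have huinvO : (u : K)⁻¹ ∈ O := hTO (Subalgebra.mem_toSubring.mpr (inv_mem_of_isUnit huu))
  have huinv : (u : K)⁻¹ ∈ seq N₀ := (hdomO N₀).2 _ huK huinvO
  have : t = t * (u : K) * (u : K)⁻¹ := by rw [mul_assoc, mul_inv_cancel₀ hu0, mul_one]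
  rw [this]
  exact (seq N₀).mul_mem htuK huinv

/-! ## Small helpers -/

/-- In a local ring, `dim ≤ 2` and `¬ dim ≤ 1` give `dim = 2`. [folklore] -/
theorem ringKrullDim_eq_two_of_not_le_one {S : Type*} [CommRing S] [IsLocalRing S]
    (hle : ringKrullDim S ≤ 2) (hnot : ¬ ringKrullDim S ≤ 1) : ringKrullDim S = 2 := by
  rw [← IsLocalRing.maximalIdeal_height_eq_ringKrullDim] at hle hnot ⊢
  have hle' : (maximalIdeal S).height ≤ 2 := WithBot.coe_le_coe.mp hle
  have hnot' : ¬ (maximalIdeal S).height ≤ 1 := fun h => hnot (by exact_mod_cast h)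
  have h2 : (2 : ℕ∞) ≤ (maximalIdeal S).height := by
    rw [not_le] at hnot'
    have := Order.add_one_le_of_lt hnot'
    rwa [one_add_one_eq_two] at this
  rw [le_antisymm hle' h2]
  rfl

/-- In a local domain which is not a field, `dim ≤ 1` gives `dim = 1`. [folklore] -/
theorem ringKrullDim_eq_one_of_le_one_of_not_isField {S : Type*} [CommRing S] [IsDomain S]
    [IsLocalRing S] (hle : ringKrullDim S ≤ 1) (hnf : ¬ IsField S) : ringKrullDim S = 1 := by
  rw [← IsLocalRing.maximalIdeal_height_eq_ringKrullDim] at hle ⊢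
  have hle' : (maximalIdeal S).height ≤ 1 := WithBot.coe_le_coe.mp hle
  have hne : (maximalIdeal S).height ≠ 0 := by
    intro h0
    have hd0 : ringKrullDim S ≤ 0 := by
      rw [← IsLocalRing.maximalIdeal_height_eq_ringKrullDim, h0]; rfl
    haveI : Ring.KrullDimLE 0 S := (Ring.krullDimLE_iff).mpr (by exact_mod_cast hd0)
    exact hnf (Ring.KrullDimLE.isField_of_isDomain)
  rw [le_antisymm hle' (Order.one_le_iff_ne_zero.mpr hne)]
  rfl

/-- Every element of `K` is a quotient of elements of any subring containing `R` (`Frac R = K`).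
[folklore] -/
theorem frac_of_le (R : Subalgebra k K) [IsFractionRing ↥R K] {B : Subring K}
    (hRB : R.toSubring ≤ B) (z : K) : ∃ a ∈ B, ∃ b ∈ B, b ≠ 0 ∧ z = a / b := by
  obtain ⟨a, b, hb, rfl⟩ := IsFractionRing.div_surjective (A := ↥R) z
  exact ⟨a, hRB a.2, b, hRB b.2, fun h => nonZeroDivisors.ne_zero hb (Subtype.ext h), rfl⟩

/-! ## S2 -/

/-- **Stub S2 `stub_regularOfBasePtsEmpty`** of skeleton v11 of line `birth` (crux `NoZenoR`
stmt-ResolutionOfSingularities-19943 / `NoZeno` stmt-16483), registered signature VERBATIM: in a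
sandwich context, a stage `T_m` (`m ≥ m₀ + 1`) with NO base point over `R` is regular.  Proof by
contradiction along `L/res-L0-w44-stub-3/S2-PLAN.md`: (0) `dim R = 2`
(`isRegularLocalRing_of_ringKrullDim_base_le_one`); (a) REACH (`tower_le_seq`): `T_m ≤ S_N` for a
least member `S_N` of the quadratic sequence of `R` along `O`, `N ≥ 1`; if `S_N` has dimension
`≤ 1` it is `O`, the transform of the two-dimensional `S_(N-1)` along `O` is `O = E_{S_(N-1)}`
(stub-3's (E)) and `S_(N-1)` is a base point; otherwise (b) the ZMT dichotomy
(`exists_exceptionalDivisor_of_ne`) yields the exceptional divisor `W`, a DVR essentially of finite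
type over `R` (`…ExitDivisorReach.lean`, `le_locAtCentre_closure_of_frac`), and (c) (stub-3) `W` is
`E_{S_j}` for some `j < N`, a base point of `T_m`. [cite: Lipman1969, §12, §18; Spivakovsky1990, §II;
ZariskiSamuel1960, Appendix 5; StacksProject, Tag 00Q9] -/
theorem stub_regularOfBasePtsEmpty (p : ℕ) (hp : p.Prime) (k K : Type) [Field k] [CharP k p]
    [Field K] [Algebra k K] (O : ValuationSubring K) (A R : Subalgebra k K) (m₀ : ℕ)
    (ctx : SandwichCtx O A R m₀) (m : ℕ) (hm : m₀ + 1 ≤ m)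
    (hempty : basePts R (tower O A m) = ∅) : IsRegularLocalRing ↥(tower O A m) := by
  classical
  have _hp := hp
  obtain ⟨hk, hA, hfr, hAO, htr, hRreg, hRfr, hRO, hlocR, hm₀⟩ := ctx
  haveI := hRreg
  haveI := hRfr
  haveI := hfr
  haveI := isDomain_of_isRegularLocalRing ↥R
  obtain ⟨n, rfl⟩ : ∃ n, m = n + 1 := ⟨m - 1, by omega⟩
  have hRT : R ≤ tower O A (n + 1) := hm₀ (n + 1) (by omega)
  by_contra hsing
  -- the stage `T = T_(n+1)`: normal Noetherian local, `Frac T = K`, `O`-local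
  haveI : IsNoetherianRing ↥(tower O A (n + 1)) := stub_towerNoetherian k K O A hk hA hfr hAO _
  haveI : IsLocalRing ↥(tower O A (n + 1)) := by
    obtain ⟨B, hBO, hTB⟩ := exists_tower_eq_loc O A hk hAO (n + 1)
    rw [hTB, loc_eq_locAt]; exact SyzygyFlattening.isLocalRing_locAt O B hBO
  haveI : IsIntegrallyClosed ↥(tower O A (n + 1)) :=
    d2rc_isIntegrallyClosed_tower_succ O A hk hA hfr hAO n
  haveI : IsFractionRing ↥(tower O A (n + 1)) K :=
    isFractionRing_subalgebra_of_le R _ hRT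
  have hTO : ∀ t ∈ tower O A (n + 1), t ∈ O :=
    fun t ht => mem_valuationSubring_of_mem_tower O hk hAO _ t ht
  have hTdom : ∀ t ∈ tower O A (n + 1), t⁻¹ ∈ O → t⁻¹ ∈ tower O A (n + 1) :=
    fun t ht htO => (valuationSubring_dominates_tower O A hk hAO (n + 1) t ht).2 htO
  -- (0) `dim R = 2`
  have hdimR : ringKrullDim ↥R = 2 := by
    by_contra hne
    apply hsing
    refine isRegularLocalRing_of_ringKrullDim_base_le_one O A hk hA hfr hAO n R hRreg ?_ hRT
    by_contra h1
    exact hne (ringKrullDim_eq_two_of_not_le_one (ringKrullDim_le_two_of_trdeg htr R) h1)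
  -- `O` dominates `R` (`loc O R = R`)
  have hdomRO : ∀ z ∈ R, z⁻¹ ∈ O → z⁻¹ ∈ R := fun z hz hzO => by
    rw [← hlocR]; exact inv_mem_loc O R hz hzO
  have h0 : SubringDominates R.toSubring O.toSubring := ⟨hRO, hdomRO⟩
  have hnf : ¬ IsField ↥R.toSubring := fun hF => by
    have h := ringKrullDim_eq_zero_of_isField hF
    have h' : ringKrullDim ↥R = 0 := h
    rw [hdimR] at h'
    exact absurd h' (by norm_num)
  have hreg0 : IsRegularLocalRing ↥R.toSubring := hRreg
  -- (a) the quadratic sequence of `R` along `O`, REACH, the least index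
  set seq : ℕ → Subring K := quadraticSeq O R.toSubring with hseqdef
  have hseq0 : seq 0 = R.toSubring := rfl
  have hstep : ∀ i, IsQuadraticTransformAlong O (seq i) (seq (i + 1)) := fun i =>
    RuledResiduesRegularModelRuled.isQuadraticTransformAlong_quadraticSeq_of_isRegularLocalRing
      hreg0 hnf h0 i
  have hmono : Monotone seq := sequence_monotone hstep
  have hdomO : ∀ i, SubringDominates (seq i) O.toSubring := fun i =>
    (sequence_dominates h0 hstep i).1
  have hregi : ∀ i, IsRegularLocalRing ↥(seq i) := isRegularLocalRing_sequence hreg0 hstep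
  have hRle : ∀ i, R.toSubring ≤ seq i := fun i => hmono (Nat.zero_le i)
  have hex : ∃ N, ∀ t ∈ tower O A (n + 1), t ∈ seq N :=
    tower_le_seq O A hk hA hfr hAO R hdimR seq hseq0 hstep h0 (n + 1)
  set N := Nat.find hex with hNdef
  have hN : ∀ t ∈ tower O A (n + 1), t ∈ seq N := Nat.find_spec hex
  have hmin : ∀ j < N, ¬ ∀ t ∈ tower O A (n + 1), t ∈ seq j := fun j hj => Nat.find_min hex hj
  -- the members as `k`-subalgebras
  let Salg : ℕ → Subalgebra k K := fun i =>
    { toSubsemiring := (seq i).toSubsemiring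
      algebraMap_mem' := fun c => hRle i (R.algebraMap_mem c) }
  have hSalg : ∀ i, (Salg i).toSubring = seq i := fun _ => rfl
  have hRS : ∀ i, R ≤ Salg i := fun i z hz => hRle i hz
  have hregS : ∀ i, IsRegularLocalRing ↥(Salg i) := fun i => hregi i
  have hfrS : ∀ i, IsFractionRing ↥(Salg i) K := fun i => isFractionRing_subalgebra_of_le R _ (hRS i)
  -- a member of dimension `≤ 1` is `O`
  have hdvr : ∀ i, ringKrullDim ↥(Salg i) ≤ 1 → seq i = O.toSubring := fun i hi =>
    RuledResiduesRegularModelRuled.eq_of_isRegularLocalRing_of_ringKrullDim_le_one (hregi i) hi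
      (frac_of_le R (hRle i)) (hdomO i)
  -- a two-dimensional member `S_i` with `T ⊄ S_i` and `E_{S_i}` dominating `T` is a base point
  have hbase : ∀ i (V : ValuationSubring K), ringKrullDim ↥(Salg i) = 2 →
      (¬ ∀ t ∈ tower O A (n + 1), t ∈ seq i) → (V : Set K) = ordSet (Salg i) →
      (∀ t ∈ tower O A (n + 1), t ∈ V) →
      (∀ t ∈ tower O A (n + 1), t⁻¹ ∈ V → t⁻¹ ∈ tower O A (n + 1)) → False := by
    intro i V hdim hnot hV hTV hVdom
    have hmem : Salg i ∈ basePts R (tower O A (n + 1)) := by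
      refine ⟨hRS i, hregS i, hdim, fun hle => hnot fun t ht => hle ht, fun t ht => ?_⟩
      rw [← hV]
      exact ⟨hTV t ht, hVdom t ht⟩
    rw [hempty] at hmem
    exact hmem
  -- case analysis on the least index `N`
  rcases Nat.eq_zero_or_pos N with hN0 | hNpos
  · -- `T ≤ S_0 = R`: `T = R` is regular
    have hTR : tower O A (n + 1) = R := by
      refine le_antisymm (fun t ht => ?_) hRT
      have h := hN t ht
      rw [hN0] at h
      exact h
    exact hsing (hTR ▸ hRreg)
  obtain ⟨M, hM⟩ : ∃ M, N = M + 1 := ⟨N - 1, by omega⟩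
  have hTS : tower O A (n + 1) ≤ Salg (M + 1) := fun t ht => by
    have h := hN t ht; rw [hM] at h; exact h
  have hnotM : ¬ ∀ t ∈ tower O A (n + 1), t ∈ seq M := hmin M (by omega)
  by_cases hS1 : ringKrullDim ↥(Salg (M + 1)) ≤ 1
  · -- DVR stage: `S_(M+1) = O`, the transform of `S_M` along `O` is `O`, so `O = E_{S_M}`
    have hSO : seq (M + 1) = O.toSubring := hdvr (M + 1) hS1
    have hM2 : ringKrullDim ↥(Salg M) = 2 := by
      refine ringKrullDim_eq_two_of_not_le_one (ringKrullDim_le_two_of_trdeg htr _) fun hM1 => ?_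
      have hMO : seq M = O.toSubring := hdvr M hM1
      exact hnotM fun t ht => by rw [hMO]; exact hTO t ht
    have hstepM : IsQuadraticTransformAlong O (Salg M).toSubring O.toSubring := by
      have h := hstep M
      rw [hSO] at h
      exact h
    -- `O = S_(M+1)` is a discrete valuation ring (regular, not a field, of dimension `≤ 1`)
    haveI := hregS (M + 1)
    haveI := isDomain_of_isRegularLocalRing ↥(Salg (M + 1))
    have hnfS : ¬ IsField ↥(Salg (M + 1)) := by
      intro hF
      apply hnf
      -- every nonzero element of `R` is inverted in `S_(M+1) ⊆ O`, hence in `R`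
      have hall : ∀ z : K, z ∈ Salg (M + 1) := fun z => by
        obtain ⟨r, hr⟩ := (IsField.localization_map_bijective (M := nonZeroDivisors ↥(Salg (M + 1)))
          (Rₘ := K) zero_notMem_nonZeroDivisors hF).2 z
        rw [← hr]; exact r.2
      refine ⟨⟨0, 1, zero_ne_one⟩, mul_comm, fun {a} ha => ?_⟩
      have ha0 : (a : K) ≠ 0 := fun h => ha (Subtype.ext h)
      have hinv : (a : K)⁻¹ ∈ R :=
        hdomRO _ a.2 ((hdomO (M + 1)).1 (hall (a : K)⁻¹))
      exact ⟨⟨(a : K)⁻¹, hinv⟩, Subtype.ext (mul_inv_cancel₀ ha0)⟩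
    have hdim1 : ringKrullDim ↥(Salg (M + 1)) = 1 :=
      ringKrullDim_eq_one_of_le_one_of_not_isField hS1 hnfS
    haveI : IsDiscreteValuationRing ↥(Salg (M + 1)) :=
      Literature.RingTheory.RegularLocalRing.isDiscreteValuationRing_of_ringKrullDim_eq_one hdim1
    haveI : IsDiscreteValuationRing ↥O :=
      Literature.RingTheory.RegularLocalRing.isDiscreteValuationRing_of_ringEquiv
        (R := ↥(Salg (M + 1))) (RingEquiv.subringCongr hSO)
    haveI := hregS M
    haveI := hfrS M
    have hOE : (O : Set K) = ordSet (Salg M) :=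
      coe_eq_ordSet_of_isQuadraticTransformAlong_self (Salg M) O (hdomO M) hstepM
    exact hbase M O hM2 hnotM hOE hTO hTdom
  · -- `S := S_(M+1)` is two-dimensional: ZMT dichotomy
    have hdimS : ringKrullDim ↥(Salg (M + 1)) = 2 :=
      ringKrullDim_eq_two_of_not_le_one (ringKrullDim_le_two_of_trdeg htr _) hS1
    haveI := hregS (M + 1)
    haveI := hfrS (M + 1)
    have hne : tower O A (n + 1) ≠ Salg (M + 1) := fun h => hsing (by rw [h]; exact hregS (M + 1))
    have hdomTS : ∀ t ∈ tower O A (n + 1), t⁻¹ ∈ Salg (M + 1) → t⁻¹ ∈ tower O A (n + 1) :=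
      fun t ht hinv => hTdom t ht ((hdomO (M + 1)).1 hinv)
    -- finiteness of `S` over `R ≤ T`
    obtain ⟨g, hg, hfrac⟩ := exists_finset_frac_of_isLocalBlowup_chain O R seq hseq0
      (fun i => (hstep i).isLocalBlowup) (M + 1)
    have hadjRT : Algebra.adjoin k ((R : Set K) ∪ ↑g) ≤
        Algebra.adjoin k ((tower O A (n + 1) : Set K) ∪ ↑g) :=
      Algebra.adjoin_mono (Set.union_subset_union_left _ hRT)
    have hfin : ∀ s ∈ Salg (M + 1), ∃ y ∈ Algebra.adjoin k ((tower O A (n + 1) : Set K) ∪ ↑g),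
        ∃ z ∈ Algebra.adjoin k ((tower O A (n + 1) : Set K) ∪ ↑g),
          z⁻¹ ∈ Salg (M + 1) ∧ s = y * z⁻¹ := by
      intro s hs
      obtain ⟨y, hy, z, hz, hzinv, -, hs⟩ := hfrac s hs
      exact ⟨y, hadjRT hy, z, hadjRT hz, hzinv, hs⟩
    -- (b) the exceptional divisor
    obtain ⟨W, hWtop, hkW, hSW, hgen, hWdomT, hnotdom, htt⟩ :=
      exists_exceptionalDivisor_of_ne htr (tower O A (n + 1)) (Salg (M + 1)) hTS hdimS hdomTS g hg
        hfin hne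
    haveI : IsDiscreteValuationRing ↥W :=
      isDiscreteValuationRing_of_residuallyTranscendental A hA hfr htr W hWtop hkW htt
    have hdomRW : ∀ r ∈ R, r⁻¹ ∈ W → r⁻¹ ∈ R := fun r hr hinv =>
      hdomRO r hr (hTO _ (hWdomT r (hRT hr) hinv))
    have hN2 : (2 : WithBot ℕ∞) ≤ ringKrullDim ↥(quadraticSeq O R.toSubring (M + 1)) := by
      have h : ringKrullDim ↥(quadraticSeq O R.toSubring (M + 1)) = ringKrullDim ↥(Salg (M + 1)) :=
        rfl
      rw [h, hdimS]
    have hWR : SubringDominates R.toSubring W.toSubring :=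
      ⟨fun z hz => hSW (hRS (M + 1) hz), hdomRW⟩
    have hWN : ¬ SubringDominates (quadraticSeq O R.toSubring (M + 1)) W.toSubring := by
      rintro ⟨-, hd⟩
      obtain ⟨t, htS, htW, htS'⟩ := hnotdom
      exact htS' (hd t htS htW)
    -- (c) an earlier member is a base point
    have hne' : (basePts R (tower O A (n + 1))).Nonempty :=
      basePts_nonempty_of_exceptional_divisor htr hdimR O h0 (tower O A (n + 1)) (M + 1)
        (fun t ht => hTS ht) (fun j hj hle => hmin j (by omega) fun t ht => hle ht) hN2 W hSW hWR
        hWdomT hWN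
    rw [hempty] at hne'
    exact Set.not_nonempty_empty hne'

end Summit.ResolutionOfSingularities.ResolutionOfSingularities.Theorems.NoZeno.SandwichCluster

end
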